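import Literature.AlgebraicGeometry.Motives.AbelianVarietyGoodReductionConjugateTate
import Literature.AlgebraicGeometry.Motives.AbelianVarietyConjugateBaseChangeAlong
import Literature.AlgebraicGeometry.Motives.AbelianVarietyTateModuleAlong
import Literature.AlgebraicGeometry.Motives.AbelianVarietyWeilPairingPullback
import HarnessLib

/-!
# «`(t^σ)~ = π(t̃) = (κt)~`, hence `t^σ = κt`» for ALL `ℓ`-power torsion points (geometric form of Shimura's step 11)

Layer `Literature/AlgebraicGeometry/Motives`, namespace
`Literature.AlgebraicGeometry.Motives.AbelianVariety.GoodReductionAt.HomReduction`.  KERNEL ONLY: theorems; no definition,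
no instance, no named fact, no `sorry`.  Companion of `Motives/AbelianVarietyGoodReductionConjugateTate` §4
(`conjPoints_eq_pointsMap_of_redHom_comp_eq`: the same statement for `K`-RATIONAL torsion points).

Setting [Shimura 1998, §18.6 proof of Thm. 18.6, p. 129–130]: `A₀/K` with good reduction `R` at `v`, `γ ∈ Aut K`, a
good-reduction datum `Rγ` of the conjugate `A₀^γ` with `e : (A₀^γ)~ ≅ Ā^{(q)}`, a pair datum `Hγ : A₀ → A₀^γ`, `ℓ`-adic
specialisation data `TA`, `Tγ` (`v ∤ ℓ`) with `Hγ` Tate-compatible, and `σ ∈ Aut K̄` extending `γ` (`K̄ = AlgebraicClosure K`),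
through which a geometric point `x ∈ A₀(K̄)` has a conjugate `x^σ ∈ A₀^γ(K̄)` (the `σ`-conjugate point of `x_{K̄} ∈ (A₀ ⊗ K̄)(K̄)`
on `(A₀ ⊗ K̄)^σ ≅ (A₀^γ) ⊗ K̄`, `Motives/AbelianVarietyConjugateBaseChangeAlong`).  HYPOTHESIS (the geometric torsion
clause of the specialisation data, Shimura's «`(t^σ)~ = π(t̃)`» for `t ∈ A[ℓᵐ](K̄)`, `σ` a Frobenius at the prime `𝔓′` of
`K̄` along which `TA`, `Tγ` reduce): `(x^σ)~ = e⁻¹(F(x̃))`.  CONCLUSION, for `κ : A₀ → A₀^γ` with `κ̃ ≫ e = F`: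
**`κ x = x^σ` for every `x ∈ A₀[ℓᵐ](K̄)`**, stated on `(A₀ ⊗ K̄)[ℓᵐ](K̄)` through the exchange isomorphism
(`map_conjugateBaseChangeAlongIso_baseChange_eq_conjPoints`) — by «`(κx)~ = κ̃(x̃)`» for the Tate-compatible pair
(`coe_reductionTorsionEquiv_redHom`) and the injectivity of reduction on the `ℓᵐ`-torsion (`reductionTorsionEquiv`).
This is the input `_hκσ` of the cell's stub S5 (row II-1 `shimura1998_thm18_6`, C′₁ + (G), B-p20); the clause is the
shape of the geometric torsion field of the II-1 specialisation fact.

## References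
* [Shimura1998] G. Shimura, *Abelian Varieties with Complex Multiplication and Modular Functions* (1998), §18.6 proof of
  Thm. 18.6 (p. 129–130: «`(t^σ)~ = π(t̃) = (κt)~` … `t^σ = κt`»), §11.1 Prop. 14 (proof: reduction of `𝔤_l(A)` modulo `𝔭′`),
  §11.2 Prop. 16.
-/

noncomputable section

open CategoryTheory CategoryTheory.Limits AlgebraicGeometry NumberField IsDedekindDomain

universe u

namespace Literature.AlgebraicGeometry.Motives

namespace AbelianVariety

/-- `e (e⁻¹ P) = P` on `L`-points for an isomorphism `e` of abelian varieties. [cite: MumfordAV1970, §4 (rational points)] -/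
theorem map_hom_map_inv_points {K : Type u} [Field K] {L : Type u} [Field L] [Algebra K L] {B C : AbelianVariety K}
    (e : B ≅ C) (P : C.Points L) :
    AlgPoints.map e.hom.hom.hom.hom (AlgPoints.map e.inv.hom.hom.hom P) = P := by
  rw [← AlgPoints.map_comp_apply]
  change AlgPoints.map (e.inv ≫ e.hom).hom.hom.hom P = P
  rw [e.inv_hom_id]
  exact AlgPoints.map_id_apply P

namespace GoodReductionAt

namespace HomReduction

variable {K : Type} [Field K] [NumberField K] {A₀ : AbelianVariety K} {v : HeightOneSpectrum (𝓞 K)}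
  {R : A₀.GoodReductionAt v} (γ : K ≃+* K) {Rγ : (A₀.conjugate γ).GoodReductionAt v}
  {p n : ℕ} [ExpChar v.asIdeal.ResidueField p] {ℓ : ℕ} [Fact ℓ.Prime]
  {TA : R.TateSpecialisation ℓ} {Tγ : Rγ.TateSpecialisation ℓ} {Hγ : HomReduction R Rγ}

/-- **«`(t^σ)~ = π(t̃) = (κt)~`, hence `t^σ = κt`» for every `ℓᵐ`-torsion point `t ∈ A₀(K̄)`** (geometric form of
Shimura's step 11, p. 130): from the geometric torsion clause «`(x^σ)~ = e⁻¹(F(x̃))`» of the specialisation data (a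
hypothesis, quantified over the conjugate point `x'` with its defining equation), the Tate compatibility of the pair datum
`Hγ`, and `κ̃ ≫ e = F`, the homomorphism `κ_{K̄}` IS `σ`-conjugation on `(A₀ ⊗ K̄)[ℓᵐ](K̄)` read through
`(A₀^γ) ⊗ K̄ ≅ (A₀ ⊗ K̄)^σ`. [cite: Shimura1998, §18.6 proof of Thm. 18.6 (p. 129–130; held chunk p0168 L9)]
[cite: Shimura1998, §11.1 Prop. 14 (proof) and §11.2 Prop. 16 (pp. 83–87)] -/
theorem map_conjugateBaseChangeAlongIso_baseChange_eq_conjPoints (e : Rγ.reduction ≅ R.reduction.frobeniusTwist p n)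
    (hH : Hγ.IsTateCompatible TA Tγ) (hℓv : (ℓ : 𝓞 K) ∉ v.asIdeal)
    (σ : AlgebraicClosure K ≃+* AlgebraicClosure K)
    (hσ : ∀ a, σ (algebraMap K (AlgebraicClosure K) a) = algebraMap K (AlgebraicClosure K) (γ a)) (m : ℕ)
    (hclause : ∀ (x : A₀.geomTorsion (ℓ ^ m : ℕ)) (x' : (A₀.conjugate γ).geomTorsion (ℓ ^ m : ℕ)),
      Additive.toMul (x' : (A₀.conjugate γ).geomPoints) =
        ((A₀.conjugate γ).pointsMulEquiv (AlgebraicClosure K)).symm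
          (AlgPoints.map (conjugateBaseChangeAlongIso γ σ hσ A₀).inv.hom.hom.hom
            ((A₀.baseChange (AlgebraicClosure K)).conjPoints σ
              (A₀.pointsMulEquiv (AlgebraicClosure K) (Additive.toMul (x : A₀.geomPoints))))) →
      (Tγ.reductionTorsionEquiv hℓv m x' : Rγ.reduction.geomPoints) =
        Hom.geomPointsMap e.inv (Hom.geomPointsMap (R.reduction.relFrobenius p n)
          (TA.reductionTorsionEquiv hℓv m x : R.reduction.geomPoints)))
    (κ : A₀ ⟶ A₀.conjugate γ) (hκ : Hγ.redHom κ ≫ e.hom = R.reduction.relFrobenius p n)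
    (y : (A₀.baseChange (AlgebraicClosure K)).torsionPoints (AlgebraicClosure K) (ℓ ^ m : ℕ)) :
    AlgPoints.map (conjugateBaseChangeAlongIso γ σ hσ A₀).hom.hom.hom.hom
        (AlgPoints.map (Hom.baseChange (AlgebraicClosure K) κ).hom.hom.hom y.1) =
      (A₀.baseChange (AlgebraicClosure K)).conjPoints σ y.1 := by
  -- the geometric point `x₀ ∈ A₀(K̄)` under `y`, torsion
  obtain ⟨y₀, hy₀⟩ := y
  obtain ⟨x₀, rfl⟩ := (A₀.pointsMulEquiv (AlgebraicClosure K)).surjective y₀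
  have hx₀ : (Additive.ofMul x₀ : A₀.geomPoints) ∈ A₀.geomTorsion (ℓ ^ m : ℕ) :=
    (mem_geomTorsion_iff _).2 (by
      rw [toMul_ofMul, mem_torsionPoints_iff, ← (A₀.pointsMulEquiv (AlgebraicClosure K)).map_eq_one_iff, map_zpow]
      exact (mem_torsionPoints_iff _ _).1 hy₀)
  -- the conjugate point `z = x₀^σ ∈ A₀^γ(K̄)` (read back from `(A₀ ⊗ K̄)^σ ≅ A₀^γ ⊗ K̄`), torsion
  have hz : ((A₀.conjugate γ).pointsMulEquiv (AlgebraicClosure K)).symm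
        (AlgPoints.map (conjugateBaseChangeAlongIso γ σ hσ A₀).inv.hom.hom.hom
          ((A₀.baseChange (AlgebraicClosure K)).conjPoints σ (A₀.pointsMulEquiv (AlgebraicClosure K) x₀))) ∈
      (A₀.conjugate γ).torsionPoints (AlgebraicClosure K) ((ℓ ^ m : ℕ) : ℤ) := by
    have h1 := map_mem_torsionPoints (conjugateBaseChangeAlongIso γ σ hσ A₀).inv
      ((conjPoints_mem_torsionPoints_iff σ _ _).2 hy₀)
    rw [mem_torsionPoints_iff] at h1 ⊢
    rw [← map_zpow, h1, map_one]
  have hz' : (Additive.ofMul (((A₀.conjugate γ).pointsMulEquiv (AlgebraicClosure K)).symm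
        (AlgPoints.map (conjugateBaseChangeAlongIso γ σ hσ A₀).inv.hom.hom.hom
          ((A₀.baseChange (AlgebraicClosure K)).conjPoints σ (A₀.pointsMulEquiv (AlgebraicClosure K) x₀)))) : (A₀.conjugate γ).geomPoints) ∈
      (A₀.conjugate γ).geomTorsion (ℓ ^ m : ℕ) :=
    (mem_geomTorsion_iff _).2 hz
  -- the clause `z̃ = e⁻¹ F x̃₀` and Tate compatibility `(κ x₀)~ = κ̃ x̃₀ = e⁻¹ F x̃₀`
  have hcl := hclause ⟨Additive.ofMul x₀, hx₀⟩ ⟨_, hz'⟩ rfl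
  have hκ' : Hγ.redHom κ = R.reduction.relFrobenius p n ≫ e.inv := by
    rw [← hκ, Category.assoc, e.hom_inv_id, Category.comp_id]
  have hTT := coe_reductionTorsionEquiv_redHom hH hℓv m κ ⟨Additive.ofMul x₀, hx₀⟩
  rw [hκ', Hom.geomPointsMap_comp, AddMonoidHom.comp_apply, ← hcl] at hTT
  -- injectivity of reduction on the `ℓᵐ`-torsion: `κ x₀ = z`
  have hinj := (Tγ.reductionTorsionEquiv hℓv m).injective (Subtype.ext hTT)
  have hpt : AlgPoints.map κ.hom.hom.hom x₀ = ((A₀.conjugate γ).pointsMulEquiv (AlgebraicClosure K)).symm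
        (AlgPoints.map (conjugateBaseChangeAlongIso γ σ hσ A₀).inv.hom.hom.hom
          ((A₀.baseChange (AlgebraicClosure K)).conjPoints σ (A₀.pointsMulEquiv (AlgebraicClosure K) x₀))) :=
    congrArg (fun t : (A₀.conjugate γ).geomTorsion (ℓ ^ m : ℕ) => Additive.toMul (t : (A₀.conjugate γ).geomPoints)) hinj
  -- read on `(A₀^γ ⊗ K̄)(K̄)` and move `e⁻¹` to the other side
  have hpt' := congrArg ((A₀.conjugate γ).pointsMulEquiv (AlgebraicClosure K)) hpt
  rw [MulEquiv.apply_symm_apply, pointsMulEquiv_map] at hpt'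
  change AlgPoints.map _ (AlgPoints.map _ (A₀.pointsMulEquiv (AlgebraicClosure K) x₀)) = _
  rw [hpt']
  exact map_hom_map_inv_points _ _

end HomReduction

end GoodReductionAt

end AbelianVariety

end Literature.AlgebraicGeometry.Motives

end
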